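import Summits.Schanuel.Schanuel.Theorems.RootDecomp1BMovingZero07

/-!
# RootDecomp1BMovingZero — lens 4, generation 35/36 «AX-TRANSVERSAL MOVING ZERO»: T″ = `IsolatedIntersectionGeneral` PROVED modulo ONE print fact (`CurveSelection`) + the tree Ax statement, and SUB-PIECE A = `AnalyticMovingZero` PROVED modulo TWO print facts (`RoucheMaps`, `IsolatedZeroLowerBound`) — continuation (RootDecomp1BMovingZero08): §X Ax 1971 for N analytic germs in (ℂ⸨X⸩, d/dX) mod the tree Ax STATEMENT `AxRankBoundLaurent` (by name): `const_or_logLine_of_isAlgebraic_taylor`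

(lens-4 g35 HOME kernels MovingZeroTpp.lean 6bf08f88…de4e (2338 l = §G03 MovingZeroGeneral03 b461aa70… + §E MovingZeroExpPoly fdd5ca6b… + §X MovingZeroAxGerms a74f0949… verbatim
bodies + NEW §T) and MovingZeroPieceA.lean 8899dedb…8da9 (238 l); ADDENDUM-2 L1857, writer re-check L1858, critic RULING L1859 (T″ VERIFIED and BOOKED; `CurveSelection`
ACCEPTED as THE ONE T-fact), RESULT/DONE L1865, critic RULING/ADDENDUM L1867 (A VERIFIED and BOOKED; `RoucheMaps` / `IsolatedZeroLowerBound` ACCEPTED AS TYPED),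
lens-4 g36 NOTE/CLAIM L1871 (PORT-READY) and critic ACK L1875 (PORT STAGING GO; credits T (L1859) and A (L1867) paid at the critic's verification of the
accepted parts carrying `isolatedIntersectionGeneral_of_curveSelection` resp. `analyticMovingZero_of_facts`); port by census-1 gen 17 as `RootDecomp1BMovingZero03`–`10`
PORT EDITS: the 44 `#guard_msgs in #print axioms` guards and their section headers dropped (HOME probes); `set_option linter.dupNamespace false` dropped; PieceA's
character-identical copy of `AnalyticMovingZero` dropped (§A's definition is used; its Facts + Proof sections follow §A in part 04); the four re-proved
`AxSchanuelTwoGerms` helpers (`exists_algDerivation_eq_derivative'`, `ofPowerSeries_taylor_exp_ne_zero'`, `algebraMap_eq_ofPowerSeries_C'`, `taylor_const'`) PRIVATE in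
part 08 (statement-twins of the unbuilt Literature module) with a notation-free private copy `taylor_const''` in part 09; `CurveSelection`'s docstring replaced by the
FACT (T-ii) text dictated in L1871 (ACK L1875); the three fact docstrings' cite KEYS normalised to references.bib (`Chirka1989`, `DAngeloSCV1993` — the gate's cite-key lint), locators unchanged; nine one-line docstrings added; statements and proofs otherwise verbatim; `AxRankBoundLaurent` stays a binder BY
NAME (discharge: HOME MovingZeroAxGermsTree.lean c3203867… once `AxSchanuelUniv` builds on the farm). `--supports stmt-Schanuel-32406`; no census credit carried;
rung 0 — nothing here proves Schanuel.)
-/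

noncomputable section

namespace Summit.Schanuel.Schanuel.Theorems.RootDecomp1BMovingZero

/-! # §X — `MovingZeroAxGerms.lean` (verbatim body) -/
section Xpart

open Complex Filter Topology Set PowerSeries HahnSeries LaurentSeries Cardinal
open scoped Nat

open Literature.NumberTheory.Transcendental
open Literature.NumberTheory.Transcendental.AndreCriterion (coeff_taylor constantCoeff_taylor
  taylor_congr taylor_add taylor_sum taylor_const_mul taylor_mul taylor_one taylor_pow)
open Literature.Analysis.Complex.FormalRoot (taylor_eq_zero_iff taylor_sub eventuallyEq_of_taylor_eq
  taylor_polynomial taylor_pow_id)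
open Literature.Analysis.Complex.LaurentGerm (derivative_taylor_exp)
open Literature.RingTheory.PowerSeries (exists_derivation_eq_derivative
  derivative_eq_zero_iff_mem_range_algebraMap)
open Literature.FieldTheory.TranscendenceDegree (trdeg_le_card_of_forall_isAlgebraic)

/-- The Taylor series of `f : ℂ → ℂ` at `0`, as a formal power series (local notation). -/
local notation3 "𝓣[" f "]" =>
  (PowerSeries.mk fun n => ((Nat.factorial n : ℂ)⁻¹ * iteratedDeriv n f 0) : PowerSeries ℂ)

/-! ### The four small helpers of `AxSchanuelTwoGerms.lean`, re-proved (that module is not built today) -/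

/-- `d/dX` as a derivation for the `ℂ`-ALGEBRA structure of `ℂ⸨X⸩` (cf. `AxTwoGerms`). [folklore] -/
private theorem exists_algDerivation_eq_derivative' :
    ∃ D : @Derivation ℂ (LaurentSeries ℂ) (LaurentSeries ℂ) _ _ _ _ _ Algebra.toModule,
      ∀ f, D f = LaurentSeries.derivative ℂ f := by
  let L : @LinearMap ℂ ℂ _ _ (RingHom.id ℂ) (LaurentSeries ℂ) (LaurentSeries ℂ) _ _
      Algebra.toModule Algebra.toModule :=
    @LinearMap.mk ℂ ℂ _ _ (RingHom.id ℂ) (LaurentSeries ℂ) (LaurentSeries ℂ) _ _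
      Algebra.toModule Algebra.toModule
      ⟨fun f => LaurentSeries.derivative ℂ f, fun f g => map_add (LaurentSeries.derivative ℂ) f g⟩
      (fun c f => by
        dsimp only
        rw [RingHom.id_apply, Algebra.smul_def, Algebra.smul_def,
          Literature.RingTheory.PowerSeries.algebraMap_laurentSeries_apply,
          Literature.RingTheory.PowerSeries.derivative_mul,
          Literature.RingTheory.PowerSeries.derivative_C, zero_mul, zero_add])
  have hL : ∀ f, L f = LaurentSeries.derivative ℂ f := fun f => rfl
  let D : @Derivation ℂ (LaurentSeries ℂ) (LaurentSeries ℂ) _ _ _ _ _ Algebra.toModule :=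
    @Derivation.mk ℂ (LaurentSeries ℂ) (LaurentSeries ℂ) _ _ _ _ _ Algebra.toModule L
      (by rw [hL]; exact Literature.RingTheory.PowerSeries.derivative_one)
      (by
        intro a b
        rw [hL, hL, hL, Literature.RingTheory.PowerSeries.derivative_mul, smul_eq_mul, smul_eq_mul]
        ring)
  exact ⟨D, fun f => rfl⟩

/-- The Taylor series of the exponential of a germ is non-zero. [folklore] -/
private theorem ofPowerSeries_taylor_exp_ne_zero' (ℓ : ℂ → ℂ) :
    (HahnSeries.ofPowerSeries ℤ ℂ 𝓣[fun z => exp (ℓ z)] : LaurentSeries ℂ) ≠ 0 := by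
  intro h
  rw [map_eq_zero_iff _ ofPowerSeries_injective] at h
  have := congrArg PowerSeries.constantCoeff h
  rw [constantCoeff_taylor, map_zero] at this
  exact Complex.exp_ne_zero _ this

/-- The algebra map `ℂ → ℂ⸨X⸩` on power series: `algebraMap c = (C c : ℂ⟦X⟧)`. [folklore] -/
private theorem algebraMap_eq_ofPowerSeries_C' (c : ℂ) :
    algebraMap ℂ (LaurentSeries ℂ) c = HahnSeries.ofPowerSeries ℤ ℂ (PowerSeries.C c) := rfl

/-- Taylor series of a constant. [folklore] -/
private theorem taylor_const' (c : ℂ) : 𝓣[fun _ : ℂ => c] = PowerSeries.C c := by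
  have h := taylor_polynomial (Polynomial.C c)
  simp only [Polynomial.eval_C] at h
  rw [h, Polynomial.coe_C]

/-- **HYPOTHESIS = the tree theorem `Ax1971.add_rank_le_trdeg_of_field` at `(k, K, m) = (ℂ, ℂ⸨X⸩, 1)`**
(Ax 1971 Thm. 3 in the differential field `(ℂ⸨X⸩, d/dX)`: for `y, z : Fin n → ℂ⸨X⸩` with `zᵢ ≠ 0`,
`D zᵢ = zᵢ D yᵢ` and the `yᵢ` `ℤ`-free modulo constants, `n + rank(D yᵢ) ≤ trdeg_ℂ ℂ(y, z)`).  PROVED in the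
tree (`Literature/NumberTheory/Transcendental/AxSchanuelUniv.lean`); carried as a hypothesis here only because
that module is `stale/unbuilt` on the farm today — discharge: `MovingZeroAxGermsTree.axRankBoundLaurent_holds`. -/
def AxRankBoundLaurent : Prop :=
  ∀ (n : ℕ) (Dv : Fin 1 → @Derivation ℂ (LaurentSeries ℂ) (LaurentSeries ℂ) _ _ _ _ _ Algebra.toModule),
    (∀ x : LaurentSeries ℂ, (∀ j, Dv j x = 0) → x ∈ Set.range (algebraMap ℂ (LaurentSeries ℂ))) →
    ∀ (y z : Fin n → LaurentSeries ℂ), (∀ i, z i ≠ 0) → (∀ j i, Dv j (z i) = z i * Dv j (y i)) →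
      (∀ q : Fin n → ℤ, (∀ j, Dv j (∑ i, (q i : LaurentSeries ℂ) * y i) = 0) → q = 0) →
        ((n + (Matrix.of fun i j => Dv j (y i)).rank : ℕ) : Cardinal) ≤
          Algebra.trdeg ℂ (Algebra.adjoin ℂ (Set.range y ∪ Set.range z))

set_option maxHeartbeats 800000 in
/-- **Ax's theorem for `N` analytic germs (exponential-algebraic alternative).** Let `ℓ₀, …, ℓ_{N-1}`
(`N ≥ 1`) be analytic at `0` and suppose the Taylor series of all `ℓᵢ` and all `e^{ℓᵢ}`, viewed in `ℂ⸨X⸩`,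
are algebraic over a subalgebra `ℂ[s]` generated by a set `s` of at most `N` Laurent series.  Then some
non-trivial INTEGER combination `Σ qᵢ ℓᵢ` is constant near `0`.  (Ax 1971 Thm. 3 with the one derivation
`d/dX` on `ℂ⸨X⸩`, constants `ℂ`: independence modulo constants would give `trdeg ≥ N + 1 > N`.)  Same proof
as the tree's two-germ version `AxTwoGerms.exists_int_rel_of_isAlgebraic_taylor`. [cite: Ax1971, Thm. 3] -/
theorem exists_int_rel_of_isAlgebraic_taylor_fin (hAx : AxRankBoundLaurent) {N : ℕ} (hN : 0 < N)
    {ℓ : Fin N → ℂ → ℂ}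
    (hℓ : ∀ i, AnalyticAt ℂ (ℓ i) 0) (s : Finset (LaurentSeries ℂ)) (hs : s.card ≤ N)
    (haL : ∀ i, IsAlgebraic (Algebra.adjoin ℂ (s : Set (LaurentSeries ℂ)))
      (HahnSeries.ofPowerSeries ℤ ℂ 𝓣[ℓ i] : LaurentSeries ℂ))
    (haE : ∀ i, IsAlgebraic (Algebra.adjoin ℂ (s : Set (LaurentSeries ℂ)))
      (HahnSeries.ofPowerSeries ℤ ℂ 𝓣[fun z => exp (ℓ i z)] : LaurentSeries ℂ)) :
    ∃ q : Fin N → ℤ, q ≠ 0 ∧ ∃ c : ℂ, ∀ᶠ z in 𝓝 (0 : ℂ), ∑ i, (q i : ℂ) * ℓ i z = c := by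
  classical
  by_contra H
  haveI : CharZero (LaurentSeries ℂ) :=
    charZero_of_injective_algebraMap (algebraMap ℂ (LaurentSeries ℂ)).injective
  obtain ⟨D, hD⟩ := exists_algDerivation_eq_derivative'
  set y : Fin N → LaurentSeries ℂ := fun i => HahnSeries.ofPowerSeries ℤ ℂ 𝓣[ℓ i] with hy
  set z : Fin N → LaurentSeries ℂ := fun i => HahnSeries.ofPowerSeries ℤ ℂ 𝓣[fun w => exp (ℓ i w)]
    with hz
  set Dv : Fin 1 → @Derivation ℂ (LaurentSeries ℂ) (LaurentSeries ℂ) _ _ _ _ _ Algebra.toModule :=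
    fun _ => D with hDv
  -- constants of `d/dX` are `ℂ`
  have hC : ∀ x : LaurentSeries ℂ, (∀ j, Dv j x = 0) →
      x ∈ Set.range (algebraMap ℂ (LaurentSeries ℂ)) := fun x hx =>
    (derivative_eq_zero_iff_mem_range_algebraMap x).1 (by rw [← hD]; exact hx 0)
  have hzne : ∀ i, z i ≠ 0 := fun i => ofPowerSeries_taylor_exp_ne_zero' (ℓ i)
  have hexp : ∀ j i, Dv j (z i) = z i * Dv j (y i) := by
    intro j i
    simp only [hDv, hD, hz, hy]
    exact derivative_taylor_exp (hℓ i)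
  -- integer combinations with zero derivative are constant near `0`
  have hcomb : ∀ q : Fin N → ℤ, D (∑ i, (q i : LaurentSeries ℂ) * y i) = 0 →
      ∃ c : ℂ, ∀ᶠ w in 𝓝 (0 : ℂ), ∑ i, (q i : ℂ) * ℓ i w = c := by
    intro q hq
    have han : ∀ i ∈ (Finset.univ : Finset (Fin N)), AnalyticAt ℂ (fun w => (q i : ℂ) * ℓ i w) 0 :=
      fun i _ => analyticAt_const.mul (hℓ i)
    have hanS : AnalyticAt ℂ (fun w => ∑ i, (q i : ℂ) * ℓ i w) 0 := by
      have hfun : (fun w => ∑ i, (q i : ℂ) * ℓ i w) = ∑ i, (fun w => (q i : ℂ) * ℓ i w) := by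
        funext w; simp only [Finset.sum_apply]
      rw [hfun]
      exact Finset.analyticAt_sum Finset.univ (fun i hi => han i hi)
    have hsum : (∑ i, (q i : LaurentSeries ℂ) * y i) =
        HahnSeries.ofPowerSeries ℤ ℂ 𝓣[fun w => ∑ i, (q i : ℂ) * ℓ i w] := by
      have hfun : (fun w => ∑ i, (q i : ℂ) * ℓ i w) = ∑ i, (fun w => (q i : ℂ) * ℓ i w) := by
        funext w; simp only [Finset.sum_apply]
      rw [hfun, taylor_sum Finset.univ han, map_sum]
      refine Finset.sum_congr rfl fun i _ => ?_
      rw [taylor_const_mul, map_mul, ofPowerSeries_C,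
        ← map_intCast (HahnSeries.C : ℂ →+* LaurentSeries ℂ) (q i)]
    rw [hsum, hD, derivative_eq_zero_iff_mem_range_algebraMap] at hq
    obtain ⟨c, hc⟩ := hq
    rw [algebraMap_eq_ofPowerSeries_C'] at hc
    have hc' := ofPowerSeries_injective hc
    rw [← taylor_const'] at hc'
    refine ⟨c, ?_⟩
    exact (eventuallyEq_of_taylor_eq analyticAt_const hanS hc').symm.mono fun w hw => hw
  have hind : ∀ q : Fin N → ℤ, (∀ j, Dv j (∑ i, (q i : LaurentSeries ℂ) * y i) = 0) → q = 0 := by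
    intro q hq
    by_contra hq0
    obtain ⟨c, hc⟩ := hcomb q (hq 0)
    exact H ⟨q, hq0, c, hc⟩
  -- `D (y i₀) ≠ 0` for `i₀ = 0`, so the rank term is `≥ 1`
  set i₀ : Fin N := ⟨0, hN⟩ with hi₀
  have hDy : D (y i₀) ≠ 0 := by
    intro h0
    have hsingle : (∑ i, ((Pi.single i₀ (1 : ℤ) : Fin N → ℤ) i : LaurentSeries ℂ) * y i) = y i₀ := by
      rw [Finset.sum_eq_single i₀]
      · simp
      · intro j _ hj
        simp [Pi.single_eq_of_ne hj]
      · intro h; exact absurd (Finset.mem_univ i₀) h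
    obtain ⟨c, hc⟩ := hcomb (Pi.single i₀ 1) (by rw [hsingle]; exact h0)
    refine H ⟨Pi.single i₀ 1, ?_, c, hc⟩
    intro h
    have := congrFun h i₀
    simp at this
  have hrank : 1 ≤ (Matrix.of fun i j => Dv j (y i)).rank := by
    rw [Matrix.rank]
    by_contra hlt
    rw [not_le, Nat.lt_one_iff] at hlt
    have hbot : LinearMap.range (Matrix.of fun i j => Dv j (y i)).mulVecLin = ⊥ :=
      Submodule.finrank_eq_zero.1 hlt
    have hmem : (Matrix.of fun i j => Dv j (y i)).mulVecLin (Pi.single 0 1) ∈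
        LinearMap.range (Matrix.of fun i j => Dv j (y i)).mulVecLin := LinearMap.mem_range_self _ _
    rw [hbot, Submodule.mem_bot, Matrix.mulVecLin_apply, Matrix.mulVec_single_one] at hmem
    have := congrFun hmem i₀
    simp only [Matrix.col_apply, Matrix.of_apply, Pi.zero_apply, hDv] at this
    exact hDy this
  -- Ax: `N + 1 ≤ trdeg`
  have hax := hAx N Dv hC y z hzne hexp hind
  have h3 : ((N + 1 : ℕ) : Cardinal) ≤ Algebra.trdeg ℂ (Algebra.adjoin ℂ (Set.range y ∪ Set.range z)) := by
    refine le_trans ?_ hax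
    have : N + 1 ≤ N + (Matrix.of fun i j => Dv j (y i)).rank := by omega
    exact_mod_cast this
  -- but everything is algebraic over `ℂ[s]`, `#s ≤ N`
  have hgen : Set.range y ∪ Set.range z ⊆
      ((Subalgebra.algebraicClosure (Algebra.adjoin ℂ (s : Set (LaurentSeries ℂ))) (LaurentSeries ℂ)).restrictScalars ℂ :
        Subalgebra ℂ (LaurentSeries ℂ)) := by
    rintro u (⟨i, rfl⟩ | ⟨i, rfl⟩)
    · exact haL i
    · exact haE i
  have hle := Algebra.adjoin_le hgen
  have halg : ∀ a ∈ Algebra.adjoin ℂ (Set.range y ∪ Set.range z),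
      IsAlgebraic (Algebra.adjoin ℂ (s : Set (LaurentSeries ℂ))) a := fun a ha => hle ha
  have h2 := trdeg_le_card_of_forall_isAlgebraic (Algebra.adjoin ℂ (Set.range y ∪ Set.range z)) s halg
  have : ((N + 1 : ℕ) : Cardinal) ≤ (N : ℕ) := (h3.trans h2).trans (by exact_mod_cast hs)
  norm_cast at this
  omega

/-- A rational-free pair: for IRRATIONAL `ρ`, `a + bρ = 0` with `a, b ∈ ℤ` forces `a = b = 0`. -/
theorem int_add_int_mul_eq_zero {ρ : ℝ} (hρ : Irrational ρ) {a b : ℤ} (h : (a : ℝ) + b * ρ = 0) :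
    a = 0 ∧ b = 0 := by
  by_cases hb : b = 0
  · rw [hb, Int.cast_zero, zero_mul, add_zero] at h
    exact ⟨by exact_mod_cast h, hb⟩
  · exfalso
    have hne : (b : ℝ) ≠ 0 := by exact_mod_cast hb
    apply hρ
    refine ⟨((-a : ℤ) : ℚ) / (b : ℚ), ?_⟩
    push_cast
    field_simp
    linarith

/-- **T″-shaped corollary (the Ax step of `IsolatedIntersectionGeneral`, RULING L1839 (T-ii)).** Let `ρ` be
irrational and `x(s), y(s)` analytic germs at `0` (in T″: the logarithms `log X, log Y` along a selected
analytic branch `γ` of `Z(F₁) ∩ Z(F₂)` through `θ′`).  Suppose the Taylor series `x̂, ŷ` lie in a subalgebra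
`ℂ[s] ⊆ ℂ⸨X⸩` with `#s ≤ 4` over which `(e^{x})^, (e^{y})^, (e^{ρx})^, (e^{ρy})^` are algebraic (in T″:
`s = {x̂, ŷ, (eˣ)^, (eʸ)^}`, and `e^{ρx}`, `e^{ρy}` are algebraic over `ℂ[(eˣ)^, (eʸ)^]` by the two GENUINE curve
relations).  Then (Ax for the four germs `x, y, ρx, ρy`: a relation `(a + cρ)x + (b + dρ)y ≡ const` with
`(a, b, c, d) ∈ ℤ⁴ ∖ 0`) EITHER `x` is constant near `0` (a «vertical» branch) OR `y = λ·x + c` near `0` with a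
REAL slope `λ = −(a + cρ)/(b + dρ)` (a «log-line»).  These are exactly the two cases closed by
`poly_family_eq_zero_of_expSum` and `logLine_top_coeff_eq_zero` of `MovingZeroExpPoly.lean`. -/
theorem const_or_logLine_of_isAlgebraic_taylor (hAx : AxRankBoundLaurent) {ρ : ℝ} (hρ : Irrational ρ)
    {x y : ℂ → ℂ}
    (hx : AnalyticAt ℂ x 0) (hy : AnalyticAt ℂ y 0) (s : Finset (LaurentSeries ℂ)) (hs : s.card ≤ 4)
    (hsx : (HahnSeries.ofPowerSeries ℤ ℂ 𝓣[x] : LaurentSeries ℂ) ∈ Algebra.adjoin ℂ (s : Set (LaurentSeries ℂ)))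
    (hsy : (HahnSeries.ofPowerSeries ℤ ℂ 𝓣[y] : LaurentSeries ℂ) ∈ Algebra.adjoin ℂ (s : Set (LaurentSeries ℂ)))
    (hEx : IsAlgebraic (Algebra.adjoin ℂ (s : Set (LaurentSeries ℂ)))
      (HahnSeries.ofPowerSeries ℤ ℂ 𝓣[fun z => exp (x z)] : LaurentSeries ℂ))
    (hEy : IsAlgebraic (Algebra.adjoin ℂ (s : Set (LaurentSeries ℂ)))
      (HahnSeries.ofPowerSeries ℤ ℂ 𝓣[fun z => exp (y z)] : LaurentSeries ℂ))
    (hEρx : IsAlgebraic (Algebra.adjoin ℂ (s : Set (LaurentSeries ℂ)))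
      (HahnSeries.ofPowerSeries ℤ ℂ 𝓣[fun z => exp ((ρ : ℂ) * x z)] : LaurentSeries ℂ))
    (hEρy : IsAlgebraic (Algebra.adjoin ℂ (s : Set (LaurentSeries ℂ)))
      (HahnSeries.ofPowerSeries ℤ ℂ 𝓣[fun z => exp ((ρ : ℂ) * y z)] : LaurentSeries ℂ)) :
    (∃ c : ℂ, ∀ᶠ z in 𝓝 (0 : ℂ), x z = c) ∨
      (∃ (lam : ℝ) (c : ℂ), ∀ᶠ z in 𝓝 (0 : ℂ), y z = (lam : ℂ) * x z + c) := by
  classical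
  -- membership ⇒ algebraicity, and `(ρ·f)^ = ρ · f̂`
  have halg_of_mem : ∀ u : LaurentSeries ℂ, u ∈ Algebra.adjoin ℂ (s : Set (LaurentSeries ℂ)) →
      IsAlgebraic (Algebra.adjoin ℂ (s : Set (LaurentSeries ℂ))) u := fun u hu =>
    isAlgebraic_algebraMap (⟨u, hu⟩ : Algebra.adjoin ℂ (s : Set (LaurentSeries ℂ)))
  have hsmul : ∀ f : ℂ → ℂ, (HahnSeries.ofPowerSeries ℤ ℂ 𝓣[fun z => (ρ : ℂ) * f z] : LaurentSeries ℂ)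
      = algebraMap ℂ (LaurentSeries ℂ) (ρ : ℂ) * HahnSeries.ofPowerSeries ℤ ℂ 𝓣[f] := by
    intro f
    rw [taylor_const_mul, map_mul, algebraMap_eq_ofPowerSeries_C']
  have hsρx : (HahnSeries.ofPowerSeries ℤ ℂ 𝓣[fun z => (ρ : ℂ) * x z] : LaurentSeries ℂ)
      ∈ Algebra.adjoin ℂ (s : Set (LaurentSeries ℂ)) := by
    rw [hsmul]
    exact Subalgebra.mul_mem _ (Subalgebra.algebraMap_mem _ _) hsx
  have hsρy : (HahnSeries.ofPowerSeries ℤ ℂ 𝓣[fun z => (ρ : ℂ) * y z] : LaurentSeries ℂ)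
      ∈ Algebra.adjoin ℂ (s : Set (LaurentSeries ℂ)) := by
    rw [hsmul]
    exact Subalgebra.mul_mem _ (Subalgebra.algebraMap_mem _ _) hsy
  -- the four germs
  set ℓ : Fin 4 → ℂ → ℂ := ![x, y, fun z => (ρ : ℂ) * x z, fun z => (ρ : ℂ) * y z] with hℓ
  have hℓan : ∀ i, AnalyticAt ℂ (ℓ i) 0 := by
    intro i
    fin_cases i
    · exact hx
    · exact hy
    · exact analyticAt_const.mul hx
    · exact analyticAt_const.mul hy
  have haL : ∀ i, IsAlgebraic (Algebra.adjoin ℂ (s : Set (LaurentSeries ℂ)))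
      (HahnSeries.ofPowerSeries ℤ ℂ 𝓣[ℓ i] : LaurentSeries ℂ) := by
    intro i
    fin_cases i
    · exact halg_of_mem _ hsx
    · exact halg_of_mem _ hsy
    · exact halg_of_mem _ hsρx
    · exact halg_of_mem _ hsρy
  have haE : ∀ i, IsAlgebraic (Algebra.adjoin ℂ (s : Set (LaurentSeries ℂ)))
      (HahnSeries.ofPowerSeries ℤ ℂ 𝓣[fun z => exp (ℓ i z)] : LaurentSeries ℂ) := by
    intro i
    fin_cases i
    · exact hEx
    · exact hEy
    · exact hEρx
    · exact hEρy
  obtain ⟨q, hq, c, hc⟩ :=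
    exists_int_rel_of_isAlgebraic_taylor_fin hAx (by norm_num) hℓan s hs haL haE
  -- the relation `(q₀ + q₂ρ) x + (q₁ + q₃ρ) y = c`
  have hrel : ∀ᶠ z in 𝓝 (0 : ℂ),
      (((q 0 : ℝ) + (q 2 : ℝ) * ρ : ℝ) : ℂ) * x z + (((q 1 : ℝ) + (q 3 : ℝ) * ρ : ℝ) : ℂ) * y z = c := by
    filter_upwards [hc] with z hz
    simp only [Fin.sum_univ_four, hℓ, Matrix.cons_val_zero, Matrix.cons_val_one, Matrix.cons_val] at hz
    push_cast
    linear_combination hz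
  by_cases hβ : (q 1 : ℝ) + (q 3 : ℝ) * ρ = 0
  · -- then `q₁ = q₃ = 0`, so `q₀ + q₂ρ ≠ 0` and `x` is constant
    obtain ⟨h1, h3⟩ := int_add_int_mul_eq_zero hρ hβ
    have hα : (q 0 : ℝ) + (q 2 : ℝ) * ρ ≠ 0 := by
      intro hα
      obtain ⟨h0, h2⟩ := int_add_int_mul_eq_zero hρ hα
      apply hq
      funext i
      fin_cases i
      · exact h0
      · exact h1
      · exact h2
      · exact h3
    have hαC : ((((q 0 : ℝ) + (q 2 : ℝ) * ρ : ℝ)) : ℂ) ≠ 0 := by exact_mod_cast hα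
    left
    refine ⟨c / (((q 0 : ℝ) + (q 2 : ℝ) * ρ : ℝ) : ℂ), ?_⟩
    filter_upwards [hrel] with z hz
    rw [hβ, Complex.ofReal_zero, zero_mul, add_zero] at hz
    exact eq_div_of_mul_eq hαC (by rw [mul_comm]; exact hz)
  · right
    have hβC : ((((q 1 : ℝ) + (q 3 : ℝ) * ρ : ℝ)) : ℂ) ≠ 0 := by exact_mod_cast hβ
    refine ⟨-(((q 0 : ℝ) + (q 2 : ℝ) * ρ) / ((q 1 : ℝ) + (q 3 : ℝ) * ρ)),
      c / (((q 1 : ℝ) + (q 3 : ℝ) * ρ : ℝ) : ℂ), ?_⟩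
    filter_upwards [hrel] with z hz
    have hyz : y z = (c - (((q 0 : ℝ) + (q 2 : ℝ) * ρ : ℝ) : ℂ) * x z) /
        (((q 1 : ℝ) + (q 3 : ℝ) * ρ : ℝ) : ℂ) :=
      eq_div_of_mul_eq hβC (by linear_combination hz)
    rw [hyz]
    push_cast
    ring

end Xpart

end Summit.Schanuel.Schanuel.Theorems.RootDecomp1BMovingZero

end
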